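import Literature.Analysis.FluidPDE.Seregin2023.TypeIIEulerZoomScenario
import HarnessLib

/-!
# Seregin 2023, Theorem 1.1: a bounded generalised Morrey quantity `M^{s,l}_κ` forces bounded
# scaled energies (a Type I situation) at the centre of the cylinder

Statements-first typing (D-0014 named fact; D-0064: §1 of the source, one file) of

* G. Seregin, *Remarks on Type II blowups of solutions to the Navier–Stokes equations*,
  arXiv:2304.04045 (2023) = Commun. Pure Appl. Anal. 23 (2024) 1389–1406 [`Seregin2023`,
  `Seregin2024`], **Theorem 1.1** (p. 3; proof outlined in Appendix III, pp. 25–26, the model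
  iteration being Proposition 7.1 of Appendix II, pp. 21–24). Page numbers are arXiv PDF pages.

> **Theorem 1.1.** Let `v` and `q` be a suitable weak solution to the Navier–Stokes equations in
> `Q`. Assume that real number `s ≥ 1` and `l ≥ 1` satisfy the restriction
> `1 > 3/s + 2/l - 1 (⟺ l > κ)` (1.4). Suppose that the condition `M = sup_{0<R<1} M^{s,l}(R) < ∞`
> (1.5), see (1.2) for the definition of `M^{s,l}(R) := M^{s,l}_κ(v, R)`, holds. Then, there exist
> positive constants `ε₀`, `c`, and `α₀ < 1` such that `𝓔(r) ≤ c r^{α₀} 𝓔(1) + c ε + c₀(s,l,ε,M)`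
> (1.6) for all `0 < r ≤ 1` and for all `0 < ε ≤ ε₀`. Moreover, `c₀` is a continuous function of
> its arguments and such that `c₀(s,l,ε,M) → 0` as `M → 0`. Here, `𝓔(r) = E(v,r) + A(v,r) + D(q,r)`.

(`E(v,r) = r⁻¹ ∫_{Q(r)} |∇v|²`, `A(v,r) = r⁻¹ sup_{-r²<t<0} ∫_{B(r)} |v|²`, `D(q,r) = r⁻² ∫_{Q(r)} |q|^{3/2}`,
p. 2 and p. 4; `M^{s,l}_κ(v,R) = R^{-κ} ∫_{-R²}^0 (∫_{B(R)} |v|^s)^{l/s}`, `κ = l(3/s + 2/l - 1)`, (1.2).)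
The theorem is the paper's "sufficient condition for the point `z = 0` to be a Type I blowup"
(p. 3): a bounded generalised Morrey quantity at the origin keeps all scaled energies there
bounded, i.e. the origin is at worst a Type I point in the energy sense (1.1). This is the printed
anchor the §B critics cite for candidate estimates of the shape "`M^{s,l}_κ` a priori bounded"
(cell `ns-regularity-ideate`, KILLKIT §E); nothing here is new mathematics and nothing here bears
on regularity.

## What is typed

* `energySumEss r v q G` — the paper's `𝓔(r) = E(v,r) + A(v,r) + D(q,r)` at the origin over the
  accepted quantities `cknE` (`G` standing for `∇v`), `cknAEss` (the ESSENTIAL supremum in `t`, the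
  faithful reading of `sup` for `v ∈ L_∞(L₂)`, as in `weightedA` of the sibling file and in
  Albritton–Barker's `A`), `cknD`.
* `morreySup s l v` — `M = sup_{0<R<1} M^{s,l}_κ(v,R)` in `ℝ≥0∞` over the sibling file's `morreyM`.
* **Theorem 1.1** as the named fact `seregin2023_morreyBound_scaledEnergies`, in the LITERAL
  quantifier order of the printed statement: the correction term `c₀` is a function of
  `(s, l, ε, M)` alone (typed as `c₀ ε M` with `s, l` fixed outermost), with `c₀(s,l,ε,M) → 0` as
  `M → 0⁺` for every admissible `ε`, while the constants `ε₀, c, α₀` are asserted to exist for each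
  solution (the printed "Let `v` and `q` be … Then, there exist positive constants …"). The proof
  (Appendix III with Prop. 7.1) produces `ε₀, c, α₀` depending on `s, l` only; that stronger,
  uniform reading is NOT asserted here (safe direction). Continuity of `c₀` is not transcribed
  (weaker conclusion).
* Proved consequences (the consumer-facing forms): under the fact, a suitable weak solution in `Q`
  with `M < ∞` and `𝓔(1) < ∞` has `𝓔(r) < ∞` for all `0 < r ≤ 1`
  (`….energySumEss_lt_top`), hence `limsup_{r→0} E(v,r) < ∞` and Seregin's 2020 blow-up index at
  the origin is finite, `g(0) < ∞` (`….blowupIndex_lt_top`): **a bounded `M^{s,l}_κ` excludes a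
  Type II blow-up at the origin in the sense of Seregin 2020, Def. 1.7** (`….not_isTypeIIAt`).

## Rendering (deviations in the safe direction)

* "Suitable weak solution in `Q`": `IsSuitableWeakSolutionInBall 1 0 v q` + a weak spatial
  gradient `G` of `v` on `Q` (`HasWeakSpatialGradientOn`), as in the sibling file.
* (1.4): `1 ≤ s`, `1 ≤ l`, `kappa s l < l` (no sign condition on `κ`, as printed for Thm 1.1).
* (1.5): `morreySup s l v < ∞`, and `M := (morreySup s l v).toReal` is fed to `c₀`.
* (1.6) in `ℝ≥0∞`: `𝓔(r) ≤ ofReal(c r^{α₀}) 𝓔(1) + ofReal(c ε) + ofReal(c₀ ε M)`.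

## Deliberately not here

Prop. 7.1 / Appendix II (the `n`-weighted version (7.4) ⇒ `A_n + E_n + D̃_n ≤ c`), Appendix I
(examples), the cases of the proof; the all-balls (Albritton–Barker) variant is
`albrittonBarker2019_lemma_2_6` (`LocalTypeIMorrey.lean`, critical Morrey member not vendored there).

## Mathlib / tree search

`lean search '3 / s + 2 / l'`, `'Morrey'`, `'Zajaczkowski2006'`: the centred generalised-Morrey
criterion is not in the tree; nearest: `albrittonBarker2019_lemma_2_6` (A–B Lemma 2.6, all sub-balls,
`A/C/E` members only), `LocalTypeIMorrey.lean`. Reused: `morreyM`, `kappa`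
(`TypeIIEulerZoomScenario.lean`), `cknE`, `cknD` (`SuitableWeak.lean`), `cknAEss`,
`IsSuitableWeakSolutionInBall`, `IsBackwardSingularPoint` (`LocalTypeI.lean`),
`Seregin2020.blowupIndex`, `Seregin2020.IsTypeIIAt` (`Seregin2020AxisymmetricTypeII.lean`).
-/

noncomputable section

open _root_.MeasureTheory _root_.Set _root_.Filter _root_.Metric _root_.Function
  _root_.TopologicalSpace
open scoped _root_.ENNReal _root_.NNReal _root_.Topology

namespace Literature.Analysis.FluidPDE.Seregin2023

/-- The paper's **sum of scaled energies** `𝓔(r) = E(v,r) + A(v,r) + D(q,r)` at the origin of the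
unit cylinder ([Seregin2023] p. 3, last display: "Here, `𝓔(r) = E(v,r) + A(v,r) + D(q,r)`"), over
the accepted `cknE` (`G` standing for `∇v`), `cknAEss` (essential supremum in `t`) and `cknD`, in
`ℝ≥0∞`. [cite: Seregin2023, §1 p. 3 (display after (1.6))] -/
def energySumEss (r : ℝ) (v : ℝ → EuclideanSpace ℝ (Fin 3) → EuclideanSpace ℝ (Fin 3))
    (q : ℝ → EuclideanSpace ℝ (Fin 3) → ℝ)
    (G : ℝ → EuclideanSpace ℝ (Fin 3) → EuclideanSpace ℝ (Fin 3) →L[ℝ] EuclideanSpace ℝ (Fin 3)) :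
    ℝ≥0∞ :=
  cknE r (0 : ℝ × EuclideanSpace ℝ (Fin 3)) G + cknAEss r (0 : ℝ × EuclideanSpace ℝ (Fin 3)) v +
    cknD r (0 : ℝ × EuclideanSpace ℝ (Fin 3)) q

/-- The paper's `M = sup_{0<R<1} M^{s,l}(R)`, `M^{s,l}(R) := M^{s,l}_κ(v, R)`, `κ = κ(s,l)`
([Seregin2023] (1.5) p. 3), in `ℝ≥0∞`, at the origin. [cite: Seregin2023, (1.5) (p. 3)] -/
def morreySup (s l : ℝ) (v : ℝ → EuclideanSpace ℝ (Fin 3) → EuclideanSpace ℝ (Fin 3)) : ℝ≥0∞ :=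
  ⨆ R ∈ Ioo (0 : ℝ) 1, morreyM (kappa s l) s l (0 : ℝ × EuclideanSpace ℝ (Fin 3)) v R

/-- Each `M^{s,l}_κ(v, R)`, `0 < R < 1`, is bounded by the supremum `M`. [cite: Seregin2023, (1.5) (p. 3)] -/
theorem morreyM_le_morreySup {s l : ℝ} {v : ℝ → EuclideanSpace ℝ (Fin 3) → EuclideanSpace ℝ (Fin 3)}
    {R : ℝ} (hR : R ∈ Ioo (0 : ℝ) 1) :
    morreyM (kappa s l) s l (0 : ℝ × EuclideanSpace ℝ (Fin 3)) v R ≤ morreySup s l v :=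
  le_iSup₂ (f := fun R (_ : R ∈ Ioo (0 : ℝ) 1) =>
    morreyM (kappa s l) s l (0 : ℝ × EuclideanSpace ℝ (Fin 3)) v R) R hR

/-- **Seregin 2023, Theorem 1.1 (bounded `M^{s,l}_κ` ⇒ Morrey-type bound on the scaled energies).**
"Let `v` and `q` be a suitable weak solution to the Navier–Stokes equations in `Q`. Assume that
real number `s ≥ 1` and `l ≥ 1` satisfy the restriction `1 > 3/s + 2/l - 1 (⟺ l > κ)` (1.4).
Suppose that the condition `M = sup_{0<R<1} M^{s,l}(R) < ∞` (1.5) holds. Then, there exist positive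
constants `ε₀`, `c`, and `α₀ < 1` such that `𝓔(r) ≤ c r^{α₀} 𝓔(1) + c ε + c₀(s,l,ε,M)` (1.6) for all
`0 < r ≤ 1` and for all `0 < ε ≤ ε₀`. Moreover, `c₀` is a continuous function of its arguments and
such that `c₀(s,l,ε,M) → 0` as `M → 0`. Here, `𝓔(r) = E(v,r) + A(v,r) + D(q,r)`." Typed in the
literal quantifier order (see the module docstring): `c₀ = c₀(ε, M)` for fixed `s, l` is solution
independent with `c₀(ε, M) → 0` as `M → 0⁺` for each `ε > 0`; `ε₀, c, α₀` may depend on the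
solution; continuity of `c₀` is not transcribed; `𝓔` with the essential supremum in `A`; (1.6) in
`ℝ≥0∞`. [cite: Seregin2023, Thm 1.1 (p. 3), with (1.2), (1.4)–(1.6)] -/
def seregin2023_morreyBound_scaledEnergies : Prop :=
  ∀ (s l : ℝ), 1 ≤ s → 1 ≤ l → kappa s l < l →
    ∃ c₀ : ℝ → ℝ → ℝ,
      (∀ ε : ℝ, 0 < ε → Tendsto (c₀ ε) (𝓝[>] 0) (𝓝 0)) ∧
      ∀ (v : ℝ → EuclideanSpace ℝ (Fin 3) → EuclideanSpace ℝ (Fin 3))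
        (q : ℝ → EuclideanSpace ℝ (Fin 3) → ℝ)
        (G : ℝ → EuclideanSpace ℝ (Fin 3) → EuclideanSpace ℝ (Fin 3) →L[ℝ] EuclideanSpace ℝ (Fin 3)),
        IsSuitableWeakSolutionInBall 1 0 v q →
        HasWeakSpatialGradientOn
          (parabolicCylinderOpens 1 (0 : ℝ × EuclideanSpace ℝ (Fin 3))) v G →
        morreySup s l v < ∞ →
        ∃ (ε₀ c α₀ : ℝ), 0 < ε₀ ∧ 0 < c ∧ 0 < α₀ ∧ α₀ < 1 ∧
          ∀ r ∈ Ioc (0 : ℝ) 1, ∀ ε ∈ Ioc (0 : ℝ) ε₀,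
            energySumEss r v q G ≤
              ENNReal.ofReal (c * r ^ α₀) * energySumEss 1 v q G + ENNReal.ofReal (c * ε) +
                ENNReal.ofReal (c₀ ε (morreySup s l v).toReal)

/-! ## Consequences: a bounded `M^{s,l}_κ` excludes an energy-Type-II blow-up at the origin -/

namespace seregin2023_morreyBound_scaledEnergies

variable {s l : ℝ} {v : ℝ → EuclideanSpace ℝ (Fin 3) → EuclideanSpace ℝ (Fin 3)}
  {q : ℝ → EuclideanSpace ℝ (Fin 3) → ℝ}
  {G : ℝ → EuclideanSpace ℝ (Fin 3) → EuclideanSpace ℝ (Fin 3) →L[ℝ] EuclideanSpace ℝ (Fin 3)}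

/-- Theorem 1.1, qualitative form: under (1.4)–(1.5), if `𝓔(1) < ∞` then `𝓔(r) < ∞` for every
`0 < r ≤ 1` — all scaled energies at the origin stay bounded ("sufficient condition for the point
`z = 0` to be a Type I blowup", [Seregin2023] p. 3). [cite: Seregin2023, Thm 1.1 (p. 3)] -/
theorem energySumEss_lt_top (h : seregin2023_morreyBound_scaledEnergies) (hs : 1 ≤ s) (hl : 1 ≤ l)
    (hκ : kappa s l < l) (hv : IsSuitableWeakSolutionInBall 1 0 v q)
    (hG : HasWeakSpatialGradientOn
      (parabolicCylinderOpens 1 (0 : ℝ × EuclideanSpace ℝ (Fin 3))) v G)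
    (hM : morreySup s l v < ∞) (h1 : energySumEss 1 v q G < ∞) {r : ℝ} (hr : r ∈ Ioc (0 : ℝ) 1) :
    energySumEss r v q G < ∞ := by
  obtain ⟨c₀, -, hc₀⟩ := h s l hs hl hκ
  obtain ⟨ε₀, c, α₀, hε₀, -, -, -, hbound⟩ := hc₀ v q G hv hG hM
  have hb := hbound r hr ε₀ ⟨hε₀, le_rfl⟩
  refine lt_of_le_of_lt hb ?_
  have h1' : ENNReal.ofReal (c * r ^ α₀) * energySumEss 1 v q G < ∞ :=
    ENNReal.mul_lt_top ENNReal.ofReal_lt_top h1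
  exact ENNReal.add_lt_top.2 ⟨ENNReal.add_lt_top.2 ⟨h1', ENNReal.ofReal_lt_top⟩,
    ENNReal.ofReal_lt_top⟩

/-- Hence the scaled dissipation `E(v, r)` at the origin is eventually bounded as `r → 0⁺`, so its
upper limit is finite. [cite: Seregin2023, Thm 1.1 (p. 3) with (1.1) (p. 2)] -/
theorem limsup_cknE_lt_top (h : seregin2023_morreyBound_scaledEnergies) (hs : 1 ≤ s) (hl : 1 ≤ l)
    (hκ : kappa s l < l) (hv : IsSuitableWeakSolutionInBall 1 0 v q)
    (hG : HasWeakSpatialGradientOn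
      (parabolicCylinderOpens 1 (0 : ℝ × EuclideanSpace ℝ (Fin 3))) v G)
    (hM : morreySup s l v < ∞) (h1 : energySumEss 1 v q G < ∞) :
    limsup (fun r => cknE r (0 : ℝ × EuclideanSpace ℝ (Fin 3)) G) (𝓝[>] 0) < ∞ := by
  obtain ⟨c₀, -, hc₀⟩ := h s l hs hl hκ
  obtain ⟨ε₀, c, α₀, hε₀, hc, hα₀, -, hbound⟩ := hc₀ v q G hv hG hM
  -- a uniform bound on `(0, 1]`: `c r^{α₀} ≤ c` there
  set B : ℝ≥0∞ := ENNReal.ofReal c * energySumEss 1 v q G + ENNReal.ofReal (c * ε₀) +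
    ENNReal.ofReal (c₀ ε₀ (morreySup s l v).toReal) with hB
  have hBtop : B < ∞ :=
    ENNReal.add_lt_top.2 ⟨ENNReal.add_lt_top.2
      ⟨ENNReal.mul_lt_top ENNReal.ofReal_lt_top h1, ENNReal.ofReal_lt_top⟩, ENNReal.ofReal_lt_top⟩
  have hev : ∀ᶠ r in 𝓝[>] (0 : ℝ), cknE r (0 : ℝ × EuclideanSpace ℝ (Fin 3)) G ≤ B := by
    have hmem : Ioc (0 : ℝ) 1 ∈ 𝓝[>] (0 : ℝ) := Ioc_mem_nhdsGT zero_lt_one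
    filter_upwards [hmem] with r hr
    have hb := hbound r hr ε₀ ⟨hε₀, le_rfl⟩
    have hE : cknE r (0 : ℝ × EuclideanSpace ℝ (Fin 3)) G ≤ energySumEss r v q G := by
      unfold energySumEss
      exact le_add_right le_self_add
    refine hE.trans (hb.trans ?_)
    have hrα : c * r ^ α₀ ≤ c := by
      have : r ^ α₀ ≤ 1 := Real.rpow_le_one hr.1.le hr.2 hα₀.le
      nlinarith
    rw [hB]
    gcongr
  exact lt_of_le_of_lt (limsup_le_of_le (by isBoundedDefault) hev) hBtop

/-- **A bounded generalised Morrey quantity excludes an energy-Type-II blow-up**: under Theorem 1.1,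
(1.4)–(1.5) and `𝓔(1) < ∞`, Seregin's 2020 blow-up index at the origin is finite,
`g(0) = min{limsup E, limsup A, limsup C} < ∞` — the origin is a regular point or a Type I blow-up
in the sense of Seregin 2020, Def. 1.7 ([Seregin2023] p. 3: "a sufficient condition for the point
`z = 0` to be a Type I blowup"). [cite: Seregin2023, Thm 1.1 and §1 p. 3; cf. Seregin2020, Def. 1.7] -/
theorem blowupIndex_lt_top (h : seregin2023_morreyBound_scaledEnergies) (hs : 1 ≤ s) (hl : 1 ≤ l)
    (hκ : kappa s l < l) (hv : IsSuitableWeakSolutionInBall 1 0 v q)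
    (hG : HasWeakSpatialGradientOn
      (parabolicCylinderOpens 1 (0 : ℝ × EuclideanSpace ℝ (Fin 3))) v G)
    (hM : morreySup s l v < ∞) (h1 : energySumEss 1 v q G < ∞) :
    Seregin2020.blowupIndex (0 : ℝ × EuclideanSpace ℝ (Fin 3)) v G < ∞ :=
  lt_of_le_of_lt (Seregin2020.blowupIndex_le_limsup_cknE _ _ _)
    (limsup_cknE_lt_top h hs hl hκ hv hG hM h1)

/-- Contrapositive in the words of Seregin 2020, Def. 1.7: under Theorem 1.1, (1.4)–(1.5) and
`𝓔(1) < ∞`, the origin is NOT a Type II blow-up (`Seregin2020.IsTypeIIAt`: backward singular point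
with `g(0) = ∞`). [cite: Seregin2023, Thm 1.1 and §1 p. 3; cf. Seregin2020, Def. 1.7] -/
theorem not_isTypeIIAt (h : seregin2023_morreyBound_scaledEnergies) (hs : 1 ≤ s) (hl : 1 ≤ l)
    (hκ : kappa s l < l) (hv : IsSuitableWeakSolutionInBall 1 0 v q)
    (hG : HasWeakSpatialGradientOn
      (parabolicCylinderOpens 1 (0 : ℝ × EuclideanSpace ℝ (Fin 3))) v G)
    (hM : morreySup s l v < ∞) (h1 : energySumEss 1 v q G < ∞) :
    ¬ Seregin2020.IsTypeIIAt (0 : ℝ × EuclideanSpace ℝ (Fin 3)) v G := fun hII =>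
  (blowupIndex_lt_top h hs hl hκ hv hG hM h1).ne hII.2

end seregin2023_morreyBound_scaledEnergies

end Literature.Analysis.FluidPDE.Seregin2023
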